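/-
Copyright (c) 2026 the pub-hodgecm-mathlib formalisation cell (harness21).  R90-TF SLAB, section S10 (Rogawski 1990, §13.8 Prop. 13.8.3 read at `v`),
prover K2Liu-p26 (g4) — DEAL #71 (b2) «SATAKE-CONSTITUENT PAYER of `hPS♭`» under RULING (R11) (S10 dealer R90-C138-plan (g4), 2026-09-05T03:28Z): the `K_H`-spherical
constituent of the frozen local factor `ρ_w` and its membership in an unramified principal series of `H_w`, HYPOTHESIS-FIRST on the one named local letter «Satake parameter
exists» (`hSat`); h413 = `stmt-HodgeConjecture-24833`, route `HCCMUnconditional`.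
-/
import Summits.HodgeConjecture.HodgeConjecture.Theorems.R90S10SphericalConstituentTraceOfGerm   -- ★ p864629 (p02): generic e.v.p. rigidity `isConstituentOf_of_unopClassSphericalCharacter_eq`, `unopClassSphericalCharacter_eq_of_isConstituentOf` (+ ★ `SphericalConstituentOfHeckeEigenvector`)
import Summits.HodgeConjecture.HodgeConjecture.Theorems.R90S10FrozenDatumDefs                   -- ★ C2′: `S10HDatum` (`ρ`, `x₀`, `KH`, `hline`, `hadm`, `hKHo`, `hKHc`), `HLoc`, `H1Loc`
import Literature.NumberTheory.Automorphic.CMPrincipalSeriesHAdmissible                         -- ★ `isAdmissible_cmPrincipalSeriesH` (+ ★ `cmPrincipalSeriesH`, the principal series `i_H(χ₂ ⊠ χ₁)` of `H_w`)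
import HarnessLib

/-!
# R90-TF ∕ S10 — (b2)♭: THE `K_H`-SPHERICAL CONSTITUENT OF THE FROZEN LOCAL FACTOR `ρ_w` AND ITS UNRAMIFIED PRINCIPAL SERIES, modulo «Satake parameter exists»
# (`Theorems/R90S10SphericalConstituentOfFrozen.lean`; ns `Summit.HodgeConjecture.HodgeConjecture.R90.S10`; THEOREMS ONLY — no `def`, no instance, no notation, no named
# fact, no `sorry`; LAW L9: ★ `Theorems` ∕ `Literature` imports only)

Print: [Rogawski1990] §13.8 Prop. 13.8.3 (proof) p. 218 L9 (ii) «`ρ_w` unramified for all finite `w ≠ v`», p. 219 L2–L3; §12.1 pp. 171–172 (the principal series `i_H(χ)` of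
`H = U(2) × U(1)`), §12.2 pp. 173–174 (the unramified member of a packet = the `K`-spherical constituent of `i(χ)`); [CartierCorvallis1979] §IV.1 Thm. 4.1, Cor. 4.1–4.2 (the
unramified irreducible admissible representations ↔ the characters of `ℋ(G, K)`; a `K`-spherical class is pinned by its Hecke eigencharacter); [Bump1997] §4.2 Prop. 4.2.3 (b);
[BorelJacquet1979] §4.4; [GetzHahn2024] §8.5 (8.15) p. 159.

## WHY (row 6 of FILE D through the keystone binder `hPS` ↦ `hPS♭`; dealer (g4) 03:22:22Z DEAL #71 + RULING (R11) 03:28:19Z; K2Liu-p13 (g5) CENSUS DEAL #69 road (b))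
The keystone's PS-realisation binder shrank to the print-true LEVEL-TRACE letter `hPS♭` («`ρ_w`'s `K_H`-level traces are those of an unramified `i_H(χ₂ ⊠ χ₁)`», payer ★-pending
K2Liu-p13 `R90S10HexOfLevelTraces`), whose own discharge is (b1) `x₀ w ≠ 0` (K2E5-p16, `R90S10FrozenLineVectorNeZero`) + (b2) «a `K_H`-spherical class `r` is a constituent of BOTH
`ρ_w` and some unramified `i_H(χ₂ ⊠ χ₁)`» + (b3) ★-pending `levelTrace_eq_of_common_sphericalConstituent` (p13).  (b2) is the local Satake∕Borel–Matsumoto classification for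
`H_w = U(Φ₂) × U(Φ₁)(L⁺_w)`; its one non-★ input is «the Hecke eigencharacter of a `K_H`-spherical class is the Satake parameter of SOME unramified `χ`» (the tree carries the
equivalent Jacquet criterion only as the hypothesis `hHC₂` of ★ `F0P3bU2PrincipalSeriesHCOfJacquetCriterion`, `N = 2`).  THIS FILE pays (b2) HYPOTHESIS-FIRST on exactly that
letter, `hSat`, stated in the e.v.p. currency of ★ `K2E1EvpOfAutomorphicClass` (`unopSphericalCharacter K I _ : ℋ(G, K) →ₐ[ℂ] ℂ`, the character of `ℋ` on the line `I^K`):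
«some `i_H(χ₂ ⊠ χ₁)` with `χ₁` smooth and a `K_H`-LINE has the parameter of `ρ_w`».  Everything else is ★ generic representation theory (p02's ★ `R90S10SphericalConstituentTraceOfGerm`
§1–§2, the rigidity fold of ★ `SphericalConstituentOfHeckeEigenvector`).

## CONTENTS (all at the frozen `H`-datum `𝔥 : S10HDatum …`, a finite `w`, a Haar measure `νHw` on `H_w` — a TOOL: the conclusions are measure-free)
* §1 `S10HDatum.finrank_fixedPoints_rho_eq_one` — off `v`, `x₀ w ≠ 0` ⇒ `dim ρ_w^{K_H} = 1` (★ field `hline : ρ_w^{K_H} = ℂ ∙ x₀ w`; (b1) supplies `x₀ w ≠ 0`).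
* §2 **`S10HDatum.exists_sphericalConstituent`** — `dim ρ_w^{K_H} = 1` ⇒ there is an ADMISSIBLE `K_H`-SPHERICAL CLASS `r`, a CONSTITUENT of `ρ_w`, WITH THE PARAMETER OF `ρ_w`
  (`unopClassSphericalCharacter K_H r _ = unopSphericalCharacter K_H ρ_w _`): the constituent through the `K_H`-line (★ `IsSpherical.exists_isHeckeEigenAt`, ★
  `IrrClass.exists_isConstituentOf_smoothTrace_doubleCoset_of_heckeEigenvector`), its parameter by ★ `unopClassSphericalCharacter_eq_of_isConstituentOf` — the `H_w`-twin of p02's ★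
  `exists_sphericalConstituent_with_parameter` (stated there at `G_w`).
* §3 **`S10HDatum.exists_sphericalConstituent_cmPrincipalSeriesH_of_satake`** — (b2)♭: under `hSat` («∃ χ₂ χ₁, `χ₁` smooth, `dim i_H(χ₂ ⊠ χ₁)^{K_H} = 1`, and `i_H(χ₂ ⊠ χ₁)` has
  the parameter of `ρ_w`»): `∃ χ₂ χ₁ r, IsOpen χ₁.ker ∧ dim i_H(χ₂ ⊠ χ₁)^{K_H} = 1 ∧ r admissible ∧ r K_H-spherical ∧ r ≼ ρ_w ∧ r ≼ i_H(χ₂ ⊠ χ₁)` — the DEAL #71 body with (q3)'s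
  `finrank` conjunct; `r ≼ i_H(χ₂ ⊠ χ₁)` by ★ `isConstituentOf_of_unopClassSphericalCharacter_eq` at the admissible `i_H(χ₂ ⊠ χ₁)` (★ `isAdmissible_cmPrincipalSeriesH`).
HONEST LABEL: ★-level helper (`--supports stmt-HodgeConjecture-24833 --as helper`); pays (b2) of `hPS♭`'s discharge ONLY MODULO the named local letter `hSat` (class (E1-c)-local,
print-true at every unramified `w`; NOT ★: it is Satake surjectivity for `𝓗(H_w, K_H)` ∕ the Jacquet criterion for `U(Φ₂)_w`) and modulo (b1) `x₀ w ≠ 0` (binder `hx₀` ∕ `hline1`);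
closes no socket by itself; HC_CM is proved only modulo the 7 printed citations (2 remaining named inputs: hLiu418 = `stmt-HodgeConjecture-24832`, h413 = `stmt-HodgeConjecture-24833`)
until rung 0 closes; REL ≠ ★ ≠ BUILT; count-neutral.

## References
* [Rogawski1990] J. D. Rogawski, *Automorphic Representations of Unitary Groups in Three Variables*, Ann. of Math. Stud. 123 (1990), §12.1 pp. 171–172; §12.2 pp. 173–174;
  §13.6 p. 209; §13.8 p. 218 L9, p. 219 L2–L3.
* [CartierCorvallis1979] P. Cartier, *Representations of 𝔭-adic groups: a survey*, Proc. Sympos. Pure Math. 33.1 (1979), §IV.1 Thm. 4.1, Cor. 4.1–4.2.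
* [Bump1997] D. Bump, *Automorphic Forms and Representations*, CUP (1997), §4.2 Prop. 4.2.3 (b).
* [BorelJacquet1979] A. Borel, H. Jacquet, *Automorphic forms and automorphic representations*, Proc. Sympos. Pure Math. 33.1 (1979), §4.4.
* [GetzHahn2024] J. R. Getz, H. Hahn, *An Introduction to Automorphic Representations*, GTM 300 (2024), §8.5 (8.15) p. 159.
-/

set_option autoImplicit false
set_option linter.dupNamespace false

noncomputable section

open MeasureTheory MulAction NumberField IsDedekindDomain
open Literature.NumberTheory.Rogawski1990 Literature.NumberTheory.Automorphic Literature.NumberTheory.Automorphic.heckeAlgebra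
open Literature.NumberTheory.Automorphic.UnitaryGroup Literature.NumberTheory.GaloisRepresentations
open Summit.HodgeConjecture.HodgeConjecture.Cruxes.H413.K2E1TraceFormulaBeta
open Summit.HodgeConjecture.HodgeConjecture.Cruxes.H413.K2E1SpectralTermsDiscreteHalf
open Summit.HodgeConjecture.HodgeConjecture.Cruxes.H413.K2E1EigenvaluePackageOfSpherical
open Summit.HodgeConjecture.HodgeConjecture.Cruxes.H413.K2E1EvpOfAutomorphicClass

namespace Summit.HodgeConjecture.HodgeConjecture.R90.S10

section Frozen

variable {L : Type} [Field L] [NumberField L] [IsCMField L] [DecidableEq (Pl L)] {μ : HeckeCharacter L} {v : Pl L}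
  [MeasurableSpace (HLoc L v)] [BorelSpace (HLoc L v)] [MeasurableSpace (Gqs L v)] [BorelSpace (Gqs L v)]
  {νHv : Measure (HLoc L v)} {νQv : Measure (Gqs L v)} [νHv.IsHaarMeasure] [νHv.IsMulRightInvariant] [νQv.IsHaarMeasure] [νQv.IsMulRightInvariant]
  [∀ a : HLoc L v, MeasurableSpace (HLoc L v ⧸ Subgroup.centralizer ({a} : Set (HLoc L v)))]
  [∀ a : HLoc L v, BorelSpace (HLoc L v ⧸ Subgroup.centralizer ({a} : Set (HLoc L v)))]
  [∀ γ : Gqs L v, MeasurableSpace (Gqs L v ⧸ Subgroup.centralizer ({γ} : Set (Gqs L v)))]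
  [∀ γ : Gqs L v, BorelSpace (Gqs L v ⧸ Subgroup.centralizer ({γ} : Set (Gqs L v)))]
  {mHv : OrbitalMeasureFamily (HLoc L v)} {mQv : OrbitalMeasureFamily (Gqs L v)} {πSt : IrrClass (HLoc L v)}
  [MeasurableSpace (H2 L).Adelic] [BorelSpace (H2 L).Adelic]
  [MeasurableSpace (GArch L)] [BorelSpace (GArch L)] [MeasurableSpace (HArch L)] [BorelSpace (HArch L)]
  [MeasurableSpace (H1Loc L v)] [MeasurableSpace (H1Arch L)] [MeasurableSpace (H1 L).Adelic] [BorelSpace (H1 L).Adelic]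

/-! ## §1 Off `v`, a non-zero distinguished vector makes `ρ_w^{K_H}` a LINE -/

/-- **`dim ρ_w^{K_{H,w}} = 1` off `v`** from the datum's `hline : ρ_w^{K_H} = ℂ ∙ x₀ w` and `x₀ w ≠ 0` ((b1), K2E5-p16's `R90S10FrozenLineVectorNeZero`): the `finrank` currency of
`hPS♭`∕(H1) (`Module.finrank_span_singleton`). [cite: Rogawski1990, §13.8 p. 218 L9, p. 219 L2–L3] -/
theorem S10HDatum.finrank_fixedPoints_rho_eq_one (𝔥 : S10HDatum L μ v νHv νQv mHv mQv πSt) {w : Pl L} (hw : w ≠ v)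
    (hx₀ : letI := 𝔥.acV w; 𝔥.x₀ w ≠ 0) :
    letI := 𝔥.acV w
    letI := 𝔥.mdV w
    Module.finrank ℂ ↥((𝔥.ρ w).fixedPoints (𝔥.KH w)) = 1 := by
  letI := 𝔥.acV w
  letI := 𝔥.mdV w
  rw [𝔥.hline w hw]
  exact finrank_span_singleton hx₀

/-! ## §2 The `K_H`-spherical constituent of `ρ_w`, with the parameter of `ρ_w` -/

/-- **THE `K_H`-SPHERICAL CONSTITUENT OF `ρ_w`, WITH ITS PARAMETER** — if `dim ρ_w^{K_{H,w}} = 1` (§1), there is an ADMISSIBLE `K_{H,w}`-SPHERICAL class `r` of `H_w` which is a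
CONSTITUENT of `ρ_w` and whose Hecke eigencharacter on `ℋ(H_w, K_{H,w})` IS THE PARAMETER of `ρ_w` (★ `unopSphericalCharacter`, the character of `ℋ` on the line `ρ_w^{K_H}`): the
constituent through the `K_H`-line (a non-zero `K_H`-fixed vector is a Hecke eigenvector, ★ `IsSpherical.exists_isHeckeEigenAt`; ★
`IrrClass.exists_isConstituentOf_smoothTrace_doubleCoset_of_heckeEigenvector` at the admissible `ρ_w`, ★ datum field `hadm`), the parameter by ★
`unopClassSphericalCharacter_eq_of_isConstituentOf` (Haar measure `νHw` on `H_w`, `νHw(K_H) ≠ 0` for the compact open `K_H` — ★ fields `hKHo`, `hKHc`).  The `H_w`-twin of ★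
`exists_sphericalConstituent_with_parameter`. [cite: CartierCorvallis1979, §IV.1 Cor. 4.1–4.2] [cite: Bump1997, §4.2 Prop. 4.2.3 (b)] [cite: Rogawski1990, §12.2 pp. 173–174; §13.8 p. 219 L2–L3] -/
theorem S10HDatum.exists_sphericalConstituent (𝔥 : S10HDatum L μ v νHv νQv mHv mQv πSt) (w : Pl L)
    [MeasurableSpace (HLoc L w)] [BorelSpace (HLoc L w)] (νHw : Measure (HLoc L w)) [νHw.IsHaarMeasure]
    (hline1 : letI := 𝔥.acV w
      letI := 𝔥.mdV w
      Module.finrank ℂ ↥((𝔥.ρ w).fixedPoints (𝔥.KH w)) = 1) :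
    letI := 𝔥.acV w
    letI := 𝔥.mdV w
    ∃ r : IrrClass (HLoc L w), r.IsConstituentOf (𝔥.ρ w) ∧ r.IsAdmissible ∧ ∃ hsph : r.IsSpherical (𝔥.KH w),
      unopClassSphericalCharacter (𝔥.KH w) r hsph = unopSphericalCharacter (𝔥.KH w) (𝔥.ρ w) hline1 := by
  letI := 𝔥.acV w
  letI := 𝔥.mdV w
  have hKo : IsOpen (𝔥.KH w : Set (HLoc L w)) := 𝔥.hKHo.out w
  have hKc : IsCompact (𝔥.KH w : Set (HLoc L w)) := 𝔥.hKHc w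
  have hμK : νHw.real (𝔥.KH w : Set (HLoc L w)) ≠ 0 :=
    (ENNReal.toReal_pos (hKo.measure_pos νHw ⟨1, (𝔥.KH w).one_mem⟩).ne' (hKc.measure_lt_top (μ := νHw)).ne).ne'
  haveI := isHeckeTriple_top_of_isCompact_isOpen (𝔥.KH w) hKc hKo
  have hfin : ∀ g : HLoc L w, (orbit (𝔥.KH w) (g : HLoc L w ⧸ 𝔥.KH w)).Finite := finite_orbit_quotient (𝔥.KH w)
  have hsphI : (𝔥.ρ w).IsSpherical (𝔥.KH w) := hline1
  -- a non-zero `K_H`-fixed vector is a Hecke eigenvector (the fixed space is a line)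
  obtain ⟨tt, htt⟩ := hsphI.exists_isHeckeEigenAt (𝔥.ρ w) (𝔥.KH w) hfin
  obtain ⟨v₀, hv₀, hv₀0⟩ := (Submodule.ne_bot_iff _).1 hsphI.isUnramified
  -- the constituent through it: admissible, `K_H`-spherical …
  obtain ⟨c, hc, hadmc, hsphc, -⟩ :=
    IrrClass.exists_isConstituentOf_smoothTrace_doubleCoset_of_heckeEigenvector νHw hKo hKc (𝔥.ρ w) (𝔥.hadm w) hv₀ hv₀0 (fun g => htt g v₀ hv₀)
  -- … and with the parameter of `ρ_w`
  exact ⟨c, hc, hadmc, hsphc, unopClassSphericalCharacter_eq_of_isConstituentOf νHw hKo hKc hμK (𝔥.hadm w) hline1 hadmc hsphc hc⟩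

/-! ## §3 (b2)♭ — the constituent lies in an unramified principal series, modulo «Satake parameter exists» -/

set_option maxHeartbeats 800000 in -- measured: the statement (two `cmPrincipalSeriesH` fixed-point types + the class-membership conjuncts) exhausts 400000 at whnf; 800000 passes (cf. ★ `cmPrincipalSeriesH_apply`, synthInstance 400000)
/-- **(b2)♭ — THE `K_H`-SPHERICAL CONSTITUENT OF `ρ_w` IS A CONSTITUENT OF AN UNRAMIFIED PRINCIPAL SERIES OF `H_w`, MODULO `hSat`.**  For the frozen `H`-datum `𝔥`, a finite
`w` with `dim ρ_w^{K_{H,w}} = 1` (§1: off `v`, given (b1) `x₀ w ≠ 0`), and the letter `hSat` «SATAKE PARAMETER EXISTS»: some principal series `i_H(χ₂ ⊠ χ₁)` of `H_w` (★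
`cmPrincipalSeriesH`) with `χ₁` smooth (`IsOpen χ₁.ker`) and a `K_{H,w}`-LINE has THE PARAMETER OF `ρ_w` on `ℋ(H_w, K_{H,w})` — there are `χ₂`, `χ₁` and an admissible
`K_{H,w}`-spherical class `r` which is a constituent of `ρ_w` AND of `i_H(χ₂ ⊠ χ₁)` (with `IsOpen χ₁.ker` and `dim i_H(χ₂ ⊠ χ₁)^{K_H} = 1` recorded): `r` is §2's constituent, and a
`K_H`-spherical admissible class with the parameter of the admissible `i_H(χ₂ ⊠ χ₁)` (★ `isAdmissible_cmPrincipalSeriesH`) is a constituent of it (★ e.v.p. rigidity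
`isConstituentOf_of_unopClassSphericalCharacter_eq`).  The body is DEAL #71's (b2) VERBATIM plus the `finrank` conjunct (q3) that `hPS♭` carries; with (b3) (K2Liu-p13) it makes
`ρ_w`'s `K_H`-level traces those of `i_H(χ₂ ⊠ χ₁)`.  `hSat` = [CartierCorvallis1979 §IV.1 Thm. 4.1] at `H_w` for the one parameter of `ρ_w` (NOT ★; named residual).
[cite: CartierCorvallis1979, §IV.1 Thm. 4.1, Cor. 4.1–4.2] [cite: Rogawski1990, §12.1 pp. 171–172; §12.2 pp. 173–174; §13.8 p. 218 L9, p. 219 L2–L3] [cite: Bump1997, §4.2 Prop. 4.2.3 (b)] -/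
theorem S10HDatum.exists_sphericalConstituent_cmPrincipalSeriesH_of_satake (𝔥 : S10HDatum L μ v νHv νQv mHv mQv πSt) (w : Pl L)
    [MeasurableSpace (HLoc L w)] [BorelSpace (HLoc L w)] (νHw : Measure (HLoc L w)) [νHw.IsHaarMeasure]
    (hline1 : letI := 𝔥.acV w
      letI := 𝔥.mdV w
      Module.finrank ℂ ↥((𝔥.ρ w).fixedPoints (𝔥.KH w)) = 1)
    (hSat : letI := 𝔥.acV w
      letI := 𝔥.mdV w
      ∃ (χ₂ : ↥(torusU (conjLocal L (IsCMField.complexConj L) w) (cmLocalForm L 2 w)) →* ℂˣ) (χ₁ : H1Loc L w →* ℂˣ),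
        IsOpen ((χ₁.ker : Subgroup (H1Loc L w)) : Set (H1Loc L w)) ∧
          ∃ hlineP : Module.finrank ℂ ↥((cmPrincipalSeriesH L w χ₂ χ₁).fixedPoints (𝔥.KH w)) = 1,
            unopSphericalCharacter (𝔥.KH w) (cmPrincipalSeriesH L w χ₂ χ₁) hlineP = unopSphericalCharacter (𝔥.KH w) (𝔥.ρ w) hline1) :
    letI := 𝔥.acV w
    letI := 𝔥.mdV w
    ∃ (χ₂ : ↥(torusU (conjLocal L (IsCMField.complexConj L) w) (cmLocalForm L 2 w)) →* ℂˣ) (χ₁ : H1Loc L w →* ℂˣ) (r : IrrClass (HLoc L w)),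
      IsOpen ((χ₁.ker : Subgroup (H1Loc L w)) : Set (H1Loc L w)) ∧ Module.finrank ℂ ↥((cmPrincipalSeriesH L w χ₂ χ₁).fixedPoints (𝔥.KH w)) = 1 ∧
        r.IsAdmissible ∧ r.IsSpherical (𝔥.KH w) ∧ r.IsConstituentOf (𝔥.ρ w) ∧ r.IsConstituentOf (cmPrincipalSeriesH L w χ₂ χ₁) := by
  letI := 𝔥.acV w
  letI := 𝔥.mdV w
  have hKo : IsOpen (𝔥.KH w : Set (HLoc L w)) := 𝔥.hKHo.out w
  have hKc : IsCompact (𝔥.KH w : Set (HLoc L w)) := 𝔥.hKHc w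
  have hμK : νHw.real (𝔥.KH w : Set (HLoc L w)) ≠ 0 :=
    (ENNReal.toReal_pos (hKo.measure_pos νHw ⟨1, (𝔥.KH w).one_mem⟩).ne' (hKc.measure_lt_top (μ := νHw)).ne).ne'
  obtain ⟨χ₂, χ₁, hχ₁, hlineP, hpar⟩ := hSat
  obtain ⟨r, hr, hadm, hsph, hparr⟩ := 𝔥.exists_sphericalConstituent w νHw hline1
  refine ⟨χ₂, χ₁, r, hχ₁, hlineP, hadm, hsph, hr, ?_⟩
  exact isConstituentOf_of_unopClassSphericalCharacter_eq νHw hKo hKc hμK (isAdmissible_cmPrincipalSeriesH L w χ₂ χ₁ hχ₁) hlineP hadm hsph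
    (hparr.trans hpar.symm)

end Frozen

end Summit.HodgeConjecture.HodgeConjecture.R90.S10

end
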